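import Literature.Barriers.CriticalPhenomena.KozmaNachmiasLemma11Steps
import Literature.Probability.Percolation.CriticalContinuityProofs
import Literature.Probability.LatticeModels.LatticeGraphProofs
import HarnessLib

/-!
# Crux `PercShatteringRace.NearLinearTwoClusterDecay` (stmt-CriticalPhenomena-5785) — frontier stub V4 `stub_vdbdChain`

Helper file of the line `pair-decay-long-arms-dense` (lead c13); lands with `--supports stmt-CriticalPhenomena-5785`
(registered stub `stub_vdbdChain` of skeleton rev L14-c13, § Point-to-point frontier).

## Statement

`stub_vdbdChain` (van den Berg–Don 2020, Lemma 16, bond percolation on `ℤ³` at `p = p_c`): write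
`q_n = 1/(6|Λ_n|)`, `Λ_n = box 3 n`, and call `v ∈ Λ_n` GOOD if `P_{p_c}(0 ↔ v in Λ_n) ≥ q_n`.  For `n ≥ 1`,
three good points `z₀, z₁, z₂ ∈ Λ_n` and a lattice point `x` within `ℓ¹`-distance `1` of
`s = z₀ + z₁ + z₂`, `P_{p_c}(0 ↔ x in Λ_{4n}) ≥ p_c q_n³`.

## Proof sketch

* The increasing events `A = {0 ↔ z₀ in Λ_n}`, `B = {z₀ ↔ z₀ + z₁ in z₀ + Λ_n}`,
  `C = {z₀ + z₁ ↔ s in z₀ + z₁ + Λ_n}` have probabilities `≥ q_n` (translation invariance,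
  `real_openConnIn_shift_box`); two applications of Harris–FKG (`harris_fkg_holds`) and concatenation
  inside `Λ_{3n}` (`mem_openConnIn_trans_of_subset`, the translated boxes lie in `Λ_{2n}`, `Λ_{3n}` by
  `image_add_box_subset`) give `P(0 ↔ s in Λ_{3n}) ≥ q_n³` (`real_chain_three_ge`).
* `Σ_c |x_c - s_c| ≤ 1` with integer entries: the sum is `0` (`x = s`; then `q_n³ ≥ p_c q_n³`) or `1`
  (`x ∼ s`, `zdGraph_adj_iff_norm_holds`).  In the second case the edge `{s, x}` is open with probability
  `p_c` (`bondPercolation_cylinder`), the event is increasing and measurable, so Harris–FKG once more and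
  the one-edge step (`mem_openConnIn_of_mem_edge`, `x ∈ Λ_{3n+1} ⊆ Λ_{4n}`) give
  `P(0 ↔ x in Λ_{4n}) ≥ p_c · P(0 ↔ s in Λ_{3n}) ≥ p_c q_n³` (`real_edge_step_ge`).

## References

* J. van den Berg, H. Don, *A lower bound for point-to-point connection probabilities in critical
  percolation*, Electron. Commun. Probab. 25 (2020), arXiv:1912.10964, Lemma 16 [VandenbergDon2020].
* G. Kozma, A. Nachmias, *Arm exponents in high dimensional percolation*, J. Amer. Math. Soc. 24
  (2011) 375–409, proof of Lemma 1.1 (the FKG chaining step) [KozmaNachmias2011].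
* G. Grimmett, *Percolation*, 2nd ed., Springer 1999, §1.6 (lattice symmetries), Thm (2.4) (FKG)
  [Grimmett1999].
-/

noncomputable section

namespace Summit.CriticalPhenomena.PercolationContinuityZ3.Theorems

namespace NearLinearTwoClusterDecayVdbdChain

open MeasureTheory
open Literature.Probability.LatticeModels Literature.Probability.Percolation
open Literature.Barriers.CriticalPhenomena

variable {d : ℕ} (p : unitInterval)

/-- A translate `v + Λ_M` of the cube by a vector `v ∈ Λ_k` lies in `Λ_N` as soon as `k + M ≤ N`.
[folklore] -/
theorem shift_box_subset_box {v : Site d} {k M N : ℕ} (hv : v ∈ box d k) (hN : k + M ≤ N) :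
    (zdShiftIso v) '' (↑(box d M) : Set (Site d)) ⊆ ↑(box d N) := by
  rw [zdShiftIso_image_box]
  exact Finset.coe_subset.2 ((image_add_box_subset hv).trans (box_mono d hN))

/-- `y + v ∈ Λ_{k+M}` for `v ∈ Λ_k`, `y ∈ Λ_M`. [folklore] -/
theorem add_mem_box {v y : Site d} {k M : ℕ} (hv : v ∈ box d k) (hy : y ∈ box d M) :
    y + v ∈ box d (k + M) :=
  image_add_box_subset hv (Finset.mem_image_of_mem (· + v) hy)

/-- **Three-link chain** (the FKG chaining of van den Berg–Don's Lemma 16 / Kozma–Nachmias' proof of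
Lemma 1.1): if `z₀, z₁, z₂ ∈ Λ_M` have `P_p(0 ↔ zᵢ in Λ_M) ≥ q ≥ 0`, then
`P_p(0 ↔ z₀ + z₁ + z₂ in Λ_{3M}) ≥ q³`. The events `{0 ↔ z₀ in Λ_M}`, `{z₀ ↔ z₁ + z₀ in z₀ + Λ_M}`,
`{z₁ + z₀ ↔ z₂ + z₁ + z₀ in (z₁ + z₀) + Λ_M}` are increasing with probabilities `≥ q` (translation
invariance), so Harris–FKG twice and concatenation inside `Λ_{3M}`.
[cite: VandenbergDon2020, Lemma 16] -/
theorem real_chain_three_ge (M : ℕ) {q : ℝ} (hq : 0 ≤ q) (z : Fin 3 → Site d)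
    (hz : ∀ i, z i ∈ box d M)
    (hP : ∀ i, q ≤ (bondPercolation (zdGraph d) p).real (openConnIn (↑(box d M) : Set (Site d)) 0 (z i))) :
    q ^ 3 ≤ (bondPercolation (zdGraph d) p).real
      (openConnIn (↑(box d (3 * M)) : Set (Site d)) 0 (z 0 + z 1 + z 2)) := by
  classical
  -- the three events
  set A : Set (BondConfig (Site d)) := openConnIn (↑(box d M) : Set (Site d)) 0 (z 0) with hA
  set B : Set (BondConfig (Site d)) :=
    openConnIn ((zdShiftIso (z 0)) '' (↑(box d M) : Set (Site d))) (z 0) (z 1 + z 0) with hB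
  set C : Set (BondConfig (Site d)) :=
    openConnIn ((zdShiftIso (z 1 + z 0)) '' (↑(box d M) : Set (Site d))) (z 1 + z 0)
      (z 2 + (z 1 + z 0)) with hC
  have hPA : q ≤ (bondPercolation (zdGraph d) p).real A := hP 0
  have hPB : q ≤ (bondPercolation (zdGraph d) p).real B := by
    rw [hB, real_openConnIn_shift_box]; exact hP 1
  have hPC : q ≤ (bondPercolation (zdGraph d) p).real C := by
    rw [hC, real_openConnIn_shift_box]; exact hP 2
  -- upper sets, measurability
  have hAu : IsUpperSet A := isUpperSet_openConnIn _ _ _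
  have hBu : IsUpperSet B := isUpperSet_openConnIn _ _ _
  have hCu : IsUpperSet C := isUpperSet_openConnIn _ _ _
  have hAm : MeasurableSet A := DCT16.measurableSet_openConnIn _ _ _
  have hBm : MeasurableSet B := by rw [hB, zdShiftIso_image_box]; exact DCT16.measurableSet_openConnIn _ _ _
  have hCm : MeasurableSet C := by rw [hC, zdShiftIso_image_box]; exact DCT16.measurableSet_openConnIn _ _ _
  -- Harris–FKG, twice
  have hAB : (bondPercolation (zdGraph d) p).real A * (bondPercolation (zdGraph d) p).real B ≤
      (bondPercolation (zdGraph d) p).real (A ∩ B) :=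
    harris_fkg_holds (zdGraph d) p hAu hBu hAm hBm
  have hABC : (bondPercolation (zdGraph d) p).real (A ∩ B) * (bondPercolation (zdGraph d) p).real C ≤
      (bondPercolation (zdGraph d) p).real (A ∩ B ∩ C) :=
    harris_fkg_holds (zdGraph d) p (hAu.inter hBu) hCu (hAm.inter hBm) hCm
  -- the intersection is a chain inside `Λ_{3M}`
  have h0 : (↑(box d M) : Set (Site d)) ⊆ ↑(box d (3 * M)) :=
    Finset.coe_subset.2 (box_mono d (by omega))
  have h1 : (zdShiftIso (z 0)) '' (↑(box d M) : Set (Site d)) ⊆ ↑(box d (3 * M)) :=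
    shift_box_subset_box (hz 0) (by omega)
  have h2 : (zdShiftIso (z 1 + z 0)) '' (↑(box d M) : Set (Site d)) ⊆ ↑(box d (3 * M)) :=
    shift_box_subset_box (add_mem_box (hz 0) (hz 1)) (by omega)
  have hsub : A ∩ B ∩ C ⊆ openConnIn (↑(box d (3 * M)) : Set (Site d)) 0 (z 0 + z 1 + z 2) := by
    rintro ω ⟨⟨hωA, hωB⟩, hωC⟩
    have h := mem_openConnIn_trans_of_subset (mem_openConnIn_trans_of_subset hωA hωB h0 h1) hωC
      subset_rfl h2
    rwa [show z 2 + (z 1 + z 0) = z 0 + z 1 + z 2 by abel] at h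
  calc q ^ 3 = q * q * q := by ring
    _ ≤ (bondPercolation (zdGraph d) p).real A * (bondPercolation (zdGraph d) p).real B *
          (bondPercolation (zdGraph d) p).real C :=
        mul_le_mul (mul_le_mul hPA hPB hq measureReal_nonneg) hPC hq
          (mul_nonneg measureReal_nonneg measureReal_nonneg)
    _ ≤ (bondPercolation (zdGraph d) p).real (A ∩ B) * (bondPercolation (zdGraph d) p).real C :=
        mul_le_mul_of_nonneg_right hAB measureReal_nonneg
    _ ≤ (bondPercolation (zdGraph d) p).real (A ∩ B ∩ C) := hABC
    _ ≤ _ := measureReal_mono hsub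

/-- **One-edge step** (Harris–FKG with the open edge `{b, c}`): for finite `S ⊆ T`, `b ∼ c`,
`b, c ∈ T`, `P_p(a ↔ c in T) ≥ p · P_p(a ↔ b in S)`. [cite: VandenbergDon2020, Lemma 16] -/
theorem real_edge_step_ge {S T : Finset (Site d)} {a b c : Site d} (hST : S ⊆ T) (hb : b ∈ T)
    (hc : c ∈ T) (hbc : (zdGraph d).Adj b c) :
    (p : ℝ) * (bondPercolation (zdGraph d) p).real (openConnIn (↑S : Set (Site d)) a b) ≤
      (bondPercolation (zdGraph d) p).real (openConnIn (↑T : Set (Site d)) a c) := by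
  classical
  set E : Set (BondConfig (Site d)) := {ω | s(b, c) ∈ ω} with hE
  have hPE : (bondPercolation (zdGraph d) p).real E = p :=
    bondPercolation_cylinder (zdGraph d) p ((SimpleGraph.mem_edgeSet _).2 hbc)
  have hEu : IsUpperSet E := fun ω ω' hle hω => hle hω
  have hEm : MeasurableSet E := measurableSet_mem _
  have hFKG : (bondPercolation (zdGraph d) p).real (openConnIn (↑S : Set (Site d)) a b) *
      (bondPercolation (zdGraph d) p).real E ≤
      (bondPercolation (zdGraph d) p).real (openConnIn (↑S : Set (Site d)) a b ∩ E) :=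
    harris_fkg_holds (zdGraph d) p (isUpperSet_openConnIn _ _ _) hEu (DCT16.measurableSet_openConnIn _ _ _)
      hEm
  have hsub : openConnIn (↑S : Set (Site d)) a b ∩ E ⊆ openConnIn (↑T : Set (Site d)) a c := by
    rintro ω ⟨h₁, h₂⟩
    exact mem_openConnIn_trans_of_subset h₁
      (mem_openConnIn_of_mem_edge (Finset.mem_coe.2 hb) (Finset.mem_coe.2 hc) hbc h₂)
      (Finset.coe_subset.2 hST) subset_rfl
  calc (p : ℝ) * (bondPercolation (zdGraph d) p).real (openConnIn (↑S : Set (Site d)) a b)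
        = (bondPercolation (zdGraph d) p).real (openConnIn (↑S : Set (Site d)) a b) *
          (bondPercolation (zdGraph d) p).real E := by rw [hPE, mul_comm]
    _ ≤ (bondPercolation (zdGraph d) p).real (openConnIn (↑S : Set (Site d)) a b ∩ E) := hFKG
    _ ≤ _ := measureReal_mono hsub

end NearLinearTwoClusterDecayVdbdChain

open MeasureTheory
open Literature.Probability.LatticeModels Literature.Probability.Percolation
open Literature.Barriers.CriticalPhenomena NearLinearTwoClusterDecayVdbdChain

/-- **Frontier stub V4 (`vdbdChain`) — van den Berg–Don 2020 Lemma 16, bond `ℤ³`.**  For `n ≥ 1`, good points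
`z₀, z₁, z₂ ∈ Λ_n` (`P_{p_c}(0 ↔ zᵢ in Λ_n) ≥ q_n = 1/(6|Λ_n|)`) and `x` within `ℓ¹`-distance `1` of
`s = z₀ + z₁ + z₂`: `P_{p_c}(0 ↔ x in Λ_{4n}) ≥ p_c q_n³`.  The increasing events `{0 ↔ z₀ in Λ_n}`,
`{z₀ ↔ z₀+z₁ in z₀+Λ_n}`, `{z₀+z₁ ↔ s in z₀+z₁+Λ_n}` (probabilities `≥ q_n` by translation invariance) and, if
`x ≠ s`, `{the edge {s, x} is open}` (probability `p_c`) live inside `Λ_{3n+1} ⊆ Λ_{4n}`; Harris–FKG and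
concatenation. [cite: VandenbergDon2020, Lemma 16] -/
theorem stub_vdbdChain :
    ∀ n : ℕ, 1 ≤ n → ∀ x : Site 3, ∀ z : Fin 3 → Site 3,
      (∀ i, z i ∈ box 3 n) →
      (∀ i, (1 : ℝ) / (6 * ((box 3 n).card : ℝ)) ≤
        (bondPercolation (zdGraph 3) (criticalProbI 3)).real (openConnIn (↑(box 3 n) : Set (Site 3)) 0 (z i))) →
      ∑ c, |x c - ∑ i, z i c| ≤ 1 →
      ((criticalProbI 3 : unitInterval) : ℝ) * ((1 : ℝ) / (6 * ((box 3 n).card : ℝ))) ^ 3 ≤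
        (bondPercolation (zdGraph 3) (criticalProbI 3)).real (openConnIn (↑(box 3 (4 * n)) : Set (Site 3)) 0 x) := by
  intro n hn x z hz hgood hdist
  set q : ℝ := (1 : ℝ) / (6 * ((box 3 n).card : ℝ)) with hq
  set s : Site 3 := z 0 + z 1 + z 2 with hs
  have hq0 : 0 ≤ q := by rw [hq]; positivity
  -- the chain `0 ↔ s in Λ_{3n}`
  have hchain : q ^ 3 ≤ (bondPercolation (zdGraph 3) (criticalProbI 3)).real
      (openConnIn (↑(box 3 (3 * n)) : Set (Site 3)) 0 s) :=
    real_chain_three_ge (criticalProbI 3) n hq0 z hz hgood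
  have hsbox : s ∈ box 3 (3 * n) := by
    have h := add_mem_box (add_mem_box (hz 0) (hz 1)) (hz 2)
    rw [hs, show z 0 + z 1 + z 2 = z 2 + (z 1 + z 0) by abel, show 3 * n = n + n + n by ring]
    exact h
  -- `Σ_c |x_c - s_c|` is `0` or `1`
  have hsum : ∀ c, ∑ i, z i c = s c := fun c => by
    rw [hs, ← Finset.sum_apply, Fin.sum_univ_three]
  simp only [hsum] at hdist
  have hnn : ∀ c, 0 ≤ |x c - s c| := fun c => abs_nonneg _
  have hsum0 : 0 ≤ ∑ c, |x c - s c| := Finset.sum_nonneg fun c _ => hnn c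
  have hpc1 : ((criticalProbI 3 : unitInterval) : ℝ) ≤ 1 := (criticalProbI 3).2.2
  have h34 : box 3 (3 * n) ⊆ box 3 (4 * n) := box_mono 3 (by omega)
  rcases (show ∑ c, |x c - s c| = 0 ∨ ∑ c, |x c - s c| = 1 by omega) with h0 | h1
  · -- `x = s`
    have hxs : x = s := by
      funext c
      have hc := (Finset.sum_eq_zero_iff_of_nonneg fun c _ => hnn c).1 h0 c (Finset.mem_univ c)
      rw [abs_eq_zero, sub_eq_zero] at hc
      exact hc
    rw [hxs]
    calc ((criticalProbI 3 : unitInterval) : ℝ) * q ^ 3 ≤ q ^ 3 :=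
          mul_le_of_le_one_left (pow_nonneg hq0 3) hpc1
      _ ≤ (bondPercolation (zdGraph 3) (criticalProbI 3)).real
            (openConnIn (↑(box 3 (3 * n)) : Set (Site 3)) 0 s) := hchain
      _ ≤ (bondPercolation (zdGraph 3) (criticalProbI 3)).real
            (openConnIn (↑(box 3 (4 * n)) : Set (Site 3)) 0 s) :=
          measureReal_mono fun ω hω => mem_openConnIn_trans_of_subset hω
            (mem_openConnIn_rfl (Finset.mem_coe.2 hsbox) ω) (Finset.coe_subset.2 h34) (Finset.coe_subset.2 h34)
  · -- `x ∼ s`: one more open edge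
    have hadj : (zdGraph 3).Adj s x := by
      rw [zdGraph_adj_iff_norm_holds]
      rw [← h1]
      exact Finset.sum_congr rfl fun c _ => abs_sub_comm _ _
    have hxbox : x ∈ box 3 (4 * n) := box_mono 3 (by omega) (mem_box_succ_of_adj hsbox hadj)
    calc ((criticalProbI 3 : unitInterval) : ℝ) * q ^ 3
          ≤ ((criticalProbI 3 : unitInterval) : ℝ) * (bondPercolation (zdGraph 3) (criticalProbI 3)).real
            (openConnIn (↑(box 3 (3 * n)) : Set (Site 3)) 0 s) :=
          mul_le_mul_of_nonneg_left hchain (criticalProbI 3).2.1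
      _ ≤ (bondPercolation (zdGraph 3) (criticalProbI 3)).real
            (openConnIn (↑(box 3 (4 * n)) : Set (Site 3)) 0 x) :=
          real_edge_step_ge (criticalProbI 3) h34 (h34 hsbox) hxbox hadj

end Summit.CriticalPhenomena.PercolationContinuityZ3.Theorems

end
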